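import Summits.AnomalousDissipation.AnomalousDissipation.Theses.TameDichotomy
import Literature.ModelTheory.ExponentialFields.OMinimalDefinability
import Literature.ModelTheory.ExponentialFields.OMinimalMonotonicityReal

/-!
# Birth skeleton (BC3) of the piece `PowerContinuity` (X₃, support, of the Euler-limit split of
`TameDichotomy.TameSteadyWitness`, crux-strategist stmt-AnomalousDissipation-2850, 2026-08-17)

Vitali along sequences, then the sequential characterisation of limits along the countably
generated filter `𝓝[>] 0`.

* `stub_limitMemLp` (Fatou + measurability of an a.e. limit of smooth fields with an `L²` bound):
  the limit field `ū` is in `L²`.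
* `stub_seqVitali` (Vitali's convergence theorem along a sequence `ν_n → 0⁺`: the powers
  `⟪f, u_{ν_n}⟫` are uniformly integrable by the `L²` bound and converge a.e.).
* `PowerContinuity_of` (real proof): `Filter.tendsto_iff_seq_tendsto`.
-/

set_option linter.dupNamespace false

noncomputable section

namespace Summit.AnomalousDissipation.AnomalousDissipation.Cruxes.TameSteadyWitness.BirthPowerContinuity

open scoped Topology InnerProductSpace
open Filter Set MeasureTheory
open Literature.Analysis.FunctionSpaces

/-- The piece `PowerContinuity` (X of this skeleton) — character-for-character the route child / the def in
`Cruxes/TameSteadyWitness/Lines/euler_limit_split_assembly.lean` (namespace-local copy so that this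
file does not depend on that module's build). -/
def PowerContinuity : Prop :=
  ∀ (f : UnitAddTorus (Fin 3) → EuclideanSpace ℝ (Fin 3)), Literature.Analysis.FunctionSpaces.Torus.IsSmooth f → ∀ (δ : ℝ) (u : ℝ → UnitAddTorus (Fin 3) → EuclideanSpace ℝ (Fin 3)) (ū : UnitAddTorus (Fin 3) → EuclideanSpace ℝ (Fin 3)), 0 < δ → (∀ ν ∈ Set.Ioo 0 δ, Literature.Analysis.FunctionSpaces.Torus.IsSmooth (u ν)) → (∃ E : ℝ, ∀ ν ∈ Set.Ioo 0 δ, ∫ x, ‖u ν x‖ ^ 2 ≤ E) → (∀ᵐ x, Filter.Tendsto (fun ν => u ν x) (nhdsWithin 0 (Set.Ioi 0)) (nhds (ū x))) → Filter.Tendsto (fun ν => ∫ x, inner ℝ (f x) (u ν x)) (nhdsWithin 0 (Set.Ioi 0)) (nhds (∫ x, inner ℝ (f x) (ū x)))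

/-- Signature of `stub_limitMemLp`: an a.e. limit (as `ν → 0⁺`) of smooth fields with
`∫ ‖u_ν‖² ≤ E` on `(0, δ)` is in `L²` (a.e.-strongly measurable as an a.e. limit along a sequence,
square-integrable by Fatou). -/
def Sig.stub_limitMemLp : Prop :=
  ∀ (δ : ℝ) (u : ℝ → UnitAddTorus (Fin 3) → EuclideanSpace ℝ (Fin 3)) (ū : UnitAddTorus (Fin 3) → EuclideanSpace ℝ (Fin 3)), 0 < δ → (∀ ν ∈ Set.Ioo 0 δ, Literature.Analysis.FunctionSpaces.Torus.IsSmooth (u ν)) → (∃ E : ℝ, ∀ ν ∈ Set.Ioo 0 δ, ∫ x, ‖u ν x‖ ^ 2 ≤ E) → (∀ᵐ x, Filter.Tendsto (fun ν => u ν x) (nhdsWithin 0 (Set.Ioi 0)) (nhds (ū x))) → MeasureTheory.MemLp ū 2 MeasureTheory.volume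

/-- Signature of `stub_seqVitali`: Vitali's convergence theorem for the powers along a sequence of
viscosities `s n → 0⁺` (uniform integrability of `⟪f, u_{s n}⟫` from the `L²` bound by
Cauchy–Schwarz, a.e. convergence inherited from the filter convergence; the finitely many `n` with
`s n ∉ (0, δ)` do not matter). -/
def Sig.stub_seqVitali : Prop :=
  ∀ (f : UnitAddTorus (Fin 3) → EuclideanSpace ℝ (Fin 3)), Literature.Analysis.FunctionSpaces.Torus.IsSmooth f → ∀ (δ : ℝ) (u : ℝ → UnitAddTorus (Fin 3) → EuclideanSpace ℝ (Fin 3)) (ū : UnitAddTorus (Fin 3) → EuclideanSpace ℝ (Fin 3)), 0 < δ → (∀ ν ∈ Set.Ioo 0 δ, Literature.Analysis.FunctionSpaces.Torus.IsSmooth (u ν)) → (∃ E : ℝ, ∀ ν ∈ Set.Ioo 0 δ, ∫ x, ‖u ν x‖ ^ 2 ≤ E) → MeasureTheory.MemLp ū 2 MeasureTheory.volume → (∀ᵐ x, Filter.Tendsto (fun ν => u ν x) (nhdsWithin 0 (Set.Ioi 0)) (nhds (ū x))) → ∀ s : ℕ → ℝ, Filter.Tendsto s Filter.atTop (nhdsWithin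 0 (Set.Ioi 0)) → Filter.Tendsto (fun n => ∫ x, inner ℝ (f x) (u (s n) x)) Filter.atTop (nhds (∫ x, inner ℝ (f x) (ū x)))

/-- STUB: the a.e. limit is in `L²` (Fatou). -/
theorem stub_limitMemLp : Sig.stub_limitMemLp := by
  sorry

/-- STUB: Vitali along sequences. -/
theorem stub_seqVitali : Sig.stub_seqVitali := by
  sorry

/-- COMPOSITION (real proof): limits along the countably generated filter `𝓝[>] 0` are detected by
sequences (`Filter.tendsto_iff_seq_tendsto`). -/
theorem PowerContinuity_of (h₁ : Sig.stub_limitMemLp) (h₂ : Sig.stub_seqVitali) : PowerContinuity := by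
  intro f hf δ u ū hδ hsm hE hae
  have hū : MeasureTheory.MemLp ū 2 MeasureTheory.volume := h₁ δ u ū hδ hsm hE hae
  rw [Filter.tendsto_iff_seq_tendsto]
  intro s hs
  exact h₂ f hf δ u ū hδ hsm hE hū hae s hs

/-- The piece, modulo the two registered stubs. -/
theorem PowerContinuity_candidate : PowerContinuity :=
  PowerContinuity_of stub_limitMemLp stub_seqVitali

end Summit.AnomalousDissipation.AnomalousDissipation.Cruxes.TameSteadyWitness.BirthPowerContinuity

end
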